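import Mathlib
import HarnessLib
import Summits.Ventures.LatticeQCDFlow.Exactness.KernelCouplingGaugeEquivariance
import Summits.Ventures.LatticeQCDFlow.Exactness.LocationCouplingMask
import Summits.Ventures.LatticeQCDFlow.Exactness.U1GaugeCovariance

/-!
# Abelian plaquette coupling layers conditioned on plaquettes are gauge equivariant — the `U(1)` flows' conditioner input class, typed

HONEST FRAMING: exact (Metropolis-corrected) sampling algorithms for lattice gauge theory;
figures of merit are autocorrelation/cost numbers at stated couplings and volumes; no
continuum-physics claim.

Venture `LatticeQCDFlow` (cell pub-lqcd), topic `Exactness`; FANOUT row 10 (`eng-equiv`, engine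
`latflow.equiv` `equiv/u1.py` + `conditioners.py`: the spline / NCP parameters of a `U(1)` plaquette
coupling are computed by a network from the PLAQUETTE ANGLES of the frozen plaquettes — Kanwar et
al., PRL 125 (2020) 121601, eqs. (11)–(13), named only).  NEW WORK of the cell over
`KernelCouplingGaugeEquivariance.isGaugeEquivariant_kernelLayer_of_comm` (abelian: conjugation
equivariance is automatic; only gauge INVARIANCE of the kernel field is needed) and
`LocationCouplingMask.isGaugeEquivariant_behindPlaquetteKernelLayer`, with row 14's
`U1GaugeCovariance.plaquetteHolonomy_gaugeTransform_of_comm` (whose docstring leaves exactly this case —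
the learned `U(1)` plaquette-coupling members — 'NOT CLAIMED').  The point typed here: in a commutative group
every plaquette holonomy is gauge INVARIANT (not just covariant), so ANY kernel field that factors
through the plaquette field — whatever the network, whichever plaquettes it reads — gives an
equivariant layer, for both plaquette choices (ahead of / behind the link).  Nothing is cited as a
fact; no number; no definition.

* **`isGaugeEquivariant_plaquetteKernelLayer_of_plaquetteFeatures`** — any mask, any plane choice,
  kernel field `hol V e = K e (x ↦ (i,j) ↦ P_{x,ij}(V))` for an ARBITRARY `K` ⟹ the plaquette
  coupling layer `V e ↦ hol V e (P) P⁻¹ V e` is `IsGaugeEquivariant`;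
* **`isGaugeEquivariant_behindPlaquetteKernelLayer_of_plaquetteFeatures`** — the same for the
  location couplings (plaquette behind the link).
With `U1SplinePlaquetteCouplingLayer` / `U1DegreeOnePlaquetteCouplingLayer` / `PlaquetteKernelLayerEquiv`
(exact, invertible) this completes "equivariant + exact + invertible" for the engine's `U(1)` layers.
-/

namespace Summit.Ventures.LatticeQCDFlow.Exactness

open Literature.MathematicalPhysics.QuantumFieldTheory

variable {d L : ℕ} {G : Type*} [CommGroup G]

/-- **Abelian plaquette coupling layers whose kernels are computed from plaquettes are gauge
equivariant.**  Any mask `p`, any plane choice `ν`, any feature-to-kernel map `K`: the kernel field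
`hol V e = K e (plaquette field of V)` is gauge invariant, hence (abelian group: conjugation
equivariance is free) the layer `V e ↦ hol V e (P) P⁻¹ V e` (active), `V e` (frozen) is
`IsGaugeEquivariant`.  (Which plaquettes `K` actually reads — the frozen ones, for the coupling
structure — is immaterial for equivariance.) -/
theorem isGaugeEquivariant_plaquetteKernelLayer_of_plaquetteFeatures (p : Edge d L → Prop) [DecidablePred p]
    (ν : Edge d L → Fin d) (K : Edge d L → (Site d L → Fin d → Fin d → G) → G → G) :
    IsGaugeEquivariant (fun (V : GaugeConfig d L G) (e : Edge d L) =>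
      if p e then K e (fun x i j => plaquetteHolonomy V x i j) (plaquetteHolonomy V e.1 e.2 (ν e)) *
          (plaquetteHolonomy V e.1 e.2 (ν e))⁻¹ * V e
      else V e) := by
  refine isGaugeEquivariant_kernelLayer_of_comm p ν (fun V e => K e fun x i j => plaquetteHolonomy V x i j)
    fun g V e _ => ?_
  simp only [plaquetteHolonomy_gaugeTransform_of_comm]

/-- **The same for the location couplings** (the plaquette BEHIND the active link drives it). -/
theorem isGaugeEquivariant_behindPlaquetteKernelLayer_of_plaquetteFeatures (p : Edge d L → Prop)
    [DecidablePred p] (ν : Edge d L → Fin d) (K : Edge d L → (Site d L → Fin d → Fin d → G) → G → G) :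
    IsGaugeEquivariant (fun (V : GaugeConfig d L G) (e : Edge d L) =>
      if p e then
        K e (fun x i j => plaquetteHolonomy V x i j)
            (V e * ((V ((e.1 - Pi.single (ν e) 1).shift e.2, ν e))⁻¹ * (V (e.1 - Pi.single (ν e) 1, e.2))⁻¹ *
              V (e.1 - Pi.single (ν e) 1, ν e))) *
          (V e * ((V ((e.1 - Pi.single (ν e) 1).shift e.2, ν e))⁻¹ * (V (e.1 - Pi.single (ν e) 1, e.2))⁻¹ *
            V (e.1 - Pi.single (ν e) 1, ν e)))⁻¹ * V e
      else V e) := by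
  refine isGaugeEquivariant_behindPlaquetteKernelLayer p ν
    (fun V e => K e fun x i j => plaquetteHolonomy V x i j) (fun g V e _ => ?_) (fun V e a b _ => ?_)
  · simp only [plaquetteHolonomy_gaugeTransform_of_comm]
  · rw [mul_inv_cancel_comm, mul_inv_cancel_comm]

end Summit.Ventures.LatticeQCDFlow.Exactness
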